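import Literature.AnabelianGeometry.SemiGraphs.TemperedCurves
import HarnessLib

/-!
# [EtTh] §1: the group-theoretic quotients of the tempered fundamental group of a once-punctured
# elliptic curve (`Π^tp_Y`, `Δ_X`, `Δ^ell_X`, `Δ^Θ_X`, `Δ_Θ`, `(Π^tp_X)^Θ`, …)

Mochizuki, *The étale theta function and its Frobenioid-theoretic manifestations*, Publ. RIMS **45**
(2009), §1, printed pp. 238–239 (PDF pp. 12–13; kurims manuscript pp. 11–12)
[cite: MochizukiEtTh2009, §1 pp.238-239]. Over the INTERFACE `OncePuncturedTemperedGroup K` of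
`TemperedCurves.lean` (the tempered fundamental group `Π^tp_X` of a stable log curve of type `(1,1)`
with split singular special fibre, its surjection onto `Z`, its profinite completion `Π_X`) this
file DEFINES — real one-line definitions, no axioms — the groups the étale theta function lives in:

* `piY` = `Π^tp_Y := Ker(Π^tp_X ↠ Z)` (open normal, `galYX : Π^tp_X/Π^tp_Y ≃ Z`), `deltaY` = `Δ^tp_Y`;
* (`deltaHat` = `Δ_X := (Δ^tp_X)^∧` = `Ker(Π_X ↠ G_K)` lives in `TemperedCurves.lean`, at the level of
  the base structure `TemperedArithmeticGroup`);
* `ellKerHat` = `[Δ_X, Δ_X]⁻`, `doubleCommutator` = `[Δ_X, [Δ_X, Δ_X]]⁻` (closed subgroups of `Π_X`),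
  `DeltaEll` = `Δ^ell_X := Δ^ab_X`, `DeltaThetaX` = `Δ^Θ_X := Δ_X/[Δ_X,[Δ_X,Δ_X]]`,
  `deltaTheta` = `Δ_Θ := Im(∧² Δ^ell_X) = Ker(Δ^Θ_X ↠ Δ^ell_X)`, `thetaToEll : Δ^Θ_X ↠ Δ^ell_X`;
* the tempered quotients "induced by the quotients `Δ_X ↠ Δ^Θ_X ↠ Δ^ell_X`": kernels `thetaKer ≤
  ellKer` in `Π^tp_X`, `PiTheta` = `(Π^tp_X)^Θ`, `PiEll` = `(Π^tp_X)^ell`, `piThetaToEll`, the images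
  `deltaTpTheta` = `(Δ^tp_X)^Θ`, `deltaTpEll` = `(Δ^tp_X)^ell`, `piYTheta` = `(Π^tp_Y)^Θ`, `piYEll` =
  `(Π^tp_Y)^ell`, `deltaYTheta`, `deltaYEll` = `(Δ^tp_Y)^ell`, and `piEllAug : (Π^tp_X)^ell ↠ G_K`
  (p. 239, "the natural surjection `(Π^tp_Y)^ell ↠ G_K`" is its restriction).

For a profinite group "`[−,−]`" is read as the closed subgroup topologically generated by
commutators, hence the closures. Deliberately NOT here: the `G_K`-module identifications
"`1 → Ẑ(1) → Δ^ell_X → Ẑ → 1`", "`∧² Δ^ell_X ≅ Ẑ(1)`", "`Δ_Θ ≅ Ẑ(1)`", "`(Δ^tp_Y)^ell ≅ Ẑ(1)`"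
(p. 238; sequel, fact names `DeltaEllExtension`, `DeltaThetaIsoTate`), and the covers `Y_N`, `Z_N`,
fields `K_N`, `J_N` (pp. 239–240, the set-up of Prop. 1.1, typed in the [EtTh] §1 file). No statement
of the paper is strengthened.
-/

open Topology Filter

noncomputable section

namespace Literature.AnabelianGeometry.SemiGraphs

universe u

namespace OncePuncturedTemperedGroup

variable {K : Type u} [Field K] (D : OncePuncturedTemperedGroup K)

/-- `Π^tp_Y := Ker(Π^tp_X ↠ Z)` ([EtTh] PRIMS p. 238). [cite: MochizukiEtTh2009, §1 p.238] -/
def piY : Subgroup D.Pi := D.zQuot.ker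

/-- `Π^tp_Y` is normal in `Π^tp_X` (a kernel). [cite: MochizukiEtTh2009, §1 p.238] -/
instance piY_normal : D.piY.Normal := by
  unfold piY; infer_instance

/-- `Π^tp_Y` is an open normal subgroup of `Π^tp_X`. [cite: MochizukiEtTh2009, §1 p.238] -/
def piYOpenNormal : OpenNormalSubgroup D.Pi :=
  { toSubgroup := D.piY, isOpen' := D.isOpen_ker_zQuot }

/-- `Z := Gal(Y/X) (≅ ℤ)` ([EtTh] PRIMS p. 238): `Π^tp_X/Π^tp_Y ≃ Z`.
[cite: MochizukiEtTh2009, §1 p.238] -/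
def galYX : D.Pi ⧸ D.piY ≃* Multiplicative ℤ :=
  QuotientGroup.quotientKerEquivOfSurjective D.zQuot D.zQuot_surjective

/-- `Δ^tp_Y := Δ^tp_X ∩ Π^tp_Y`, the geometric part of `Π^tp_Y` ([EtTh] PRIMS p. 238).
[cite: MochizukiEtTh2009, §1 p.238] -/
def deltaY : Subgroup D.Pi := D.delta ⊓ D.piY

/-- "`Δ_X` is a profinite free group on 2 generators" ([EtTh] PRIMS p. 238), the interface axiom
re-read over the definition `deltaHat`. [cite: MochizukiEtTh2009, §1 p.238] -/
theorem deltaHat_isFree : ∃ x : Fin 2 → D.deltaHat, IsFreeProfiniteOn D.deltaHat x :=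
  D.deltaHat_free

/-- The closed commutator subgroup `[Δ_X, Δ_X]` of `Δ_X`, computed in `Π_X` ([EtTh] PRIMS p. 238:
`Δ^ell_X := Δ^ab_X = Δ_X/[Δ_X, Δ_X]`; for profinite groups the bracket is the closed subgroup
generated by commutators). [cite: MochizukiEtTh2009, §1 p.238] -/
def ellKerHat : Subgroup D.PiHat := (⁅D.deltaHat, D.deltaHat⁆).topologicalClosure

/-- The closed double commutator `[Δ_X, [Δ_X, Δ_X]]` ([EtTh] PRIMS p. 238:
`Δ^Θ_X := Δ_X/[Δ_X, [Δ_X, Δ_X]]`). [cite: MochizukiEtTh2009, §1 p.238] -/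
def doubleCommutator : Subgroup D.PiHat := (⁅D.deltaHat, ⁅D.deltaHat, D.deltaHat⁆⁆).topologicalClosure

/-- `[Δ_X, Δ_X]⁻` is normal in `Π_X`. [cite: MochizukiEtTh2009, §1 p.238] -/
instance ellKerHat_normal : D.ellKerHat.Normal := by
  unfold ellKerHat; exact Subgroup.is_normal_topologicalClosure _

/-- `[Δ_X, [Δ_X, Δ_X]]⁻` is normal in `Π_X`. [cite: MochizukiEtTh2009, §1 p.238] -/
instance doubleCommutator_normal : D.doubleCommutator.Normal := by
  unfold doubleCommutator; exact Subgroup.is_normal_topologicalClosure _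

/-- `[Δ_X, [Δ_X, Δ_X]]⁻ ≤ [Δ_X, Δ_X]⁻`. [cite: MochizukiEtTh2009, §1 p.238] -/
theorem doubleCommutator_le_ellKerHat : D.doubleCommutator ≤ D.ellKerHat :=
  Subgroup.topologicalClosure_mono
    (Subgroup.commutator_mono le_rfl (Subgroup.commutator_le_left _ _))

/-- `[Δ_X, Δ_X]⁻ ≤ Δ_X`. [cite: MochizukiEtTh2009, §1 p.238] -/
theorem ellKerHat_le_deltaHat : D.ellKerHat ≤ D.deltaHat :=
  Subgroup.topologicalClosure_minimal _ (Subgroup.commutator_le_left _ _) D.isClosed_deltaHat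

/-- `Δ^ell_X := Δ^ab_X = Δ_X/[Δ_X, Δ_X]` ([EtTh] PRIMS p. 238), the topological abelianisation of
the profinite group `Δ_X` (quotient by the closed commutator subgroup).
[cite: MochizukiEtTh2009, §1 p.238] -/
abbrev DeltaEll : Type u := D.deltaHat ⧸ D.ellKerHat.subgroupOf D.deltaHat

/-- `Δ^Θ_X := Δ_X/[Δ_X, [Δ_X, Δ_X]]` ([EtTh] PRIMS p. 238). [cite: MochizukiEtTh2009, §1 p.238] -/
abbrev DeltaThetaX : Type u := D.deltaHat ⧸ D.doubleCommutator.subgroupOf D.deltaHat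

/-- `Δ_Θ ⊆ Δ^Θ_X`: "the image of `∧² Δ^ell_X` in `Δ^Θ_X`" ([EtTh] PRIMS p. 238), i.e. the image of
`[Δ_X, Δ_X]⁻` in `Δ^Θ_X` — the kernel of `Δ^Θ_X ↠ Δ^ell_X` in
"`1 → ∧² Δ^ell_X (≅ Ẑ(1)) → Δ^Θ_X → Δ^ell_X → 1`". [cite: MochizukiEtTh2009, §1 p.238] -/
def deltaTheta : Subgroup D.DeltaThetaX :=
  (D.ellKerHat.subgroupOf D.deltaHat).map (QuotientGroup.mk' _)

/-- The projection `Δ^Θ_X ↠ Δ^ell_X` ([EtTh] PRIMS p. 238). [cite: MochizukiEtTh2009, §1 p.238] -/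
def thetaToEll : D.DeltaThetaX →* D.DeltaEll :=
  QuotientGroup.map _ _ (MonoidHom.id _) (by
    rw [Subgroup.comap_id]
    exact fun x hx => D.doubleCommutator_le_ellKerHat hx)

/-! #### The tempered quotients (PRIMS p. 238) -/

/-- `Ker(Π^tp_X ↠ (Π^tp_X)^Θ) = Ker(Δ^tp_X ↠ (Δ^tp_X)^Θ)`: the elements of `Δ^tp_X` whose image in
`Π_X` lies in `[Δ_X, [Δ_X, Δ_X]]⁻` ([EtTh] PRIMS p. 238: "the quotients whose kernels are the
kernels of the quotients `Δ^tp_X ↠ (Δ^tp_X)^Θ ↠ (Δ^tp_X)^ell`", these being "induced by the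
quotients `Δ_X ↠ Δ^Θ_X ↠ Δ^ell_X`"). [cite: MochizukiEtTh2009, §1 p.238] -/
def thetaKer : Subgroup D.Pi := D.delta ⊓ D.doubleCommutator.comap D.toHat.toMonoidHom

/-- `Ker(Π^tp_X ↠ (Π^tp_X)^ell) = Ker(Δ^tp_X ↠ (Δ^tp_X)^ell)`: the elements of `Δ^tp_X` whose image
in `Π_X` lies in `[Δ_X, Δ_X]⁻` ([EtTh] PRIMS p. 238). [cite: MochizukiEtTh2009, §1 p.238] -/
def ellKer : Subgroup D.Pi := D.delta ⊓ D.ellKerHat.comap D.toHat.toMonoidHom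

/-- `thetaKer` is normal in `Π^tp_X`. [cite: MochizukiEtTh2009, §1 p.238] -/
instance thetaKer_normal : D.thetaKer.Normal := by
  unfold thetaKer; exact Subgroup.normal_inf_normal _ _

/-- `ellKer` is normal in `Π^tp_X`. [cite: MochizukiEtTh2009, §1 p.238] -/
instance ellKer_normal : D.ellKer.Normal := by
  unfold ellKer; exact Subgroup.normal_inf_normal _ _

/-- `thetaKer ≤ ellKer`. [cite: MochizukiEtTh2009, §1 p.238] -/
theorem thetaKer_le_ellKer : D.thetaKer ≤ D.ellKer :=
  inf_le_inf_left _ (Subgroup.comap_mono D.doubleCommutator_le_ellKerHat)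

/-- `(Π^tp_X)^Θ` ([EtTh] PRIMS p. 238). [cite: MochizukiEtTh2009, §1 p.238] -/
abbrev PiTheta : Type u := D.Pi ⧸ D.thetaKer

/-- `(Π^tp_X)^ell` ([EtTh] PRIMS p. 238). [cite: MochizukiEtTh2009, §1 p.238] -/
abbrev PiEll : Type u := D.Pi ⧸ D.ellKer

/-- `(Δ^tp_X)^Θ ⊆ (Π^tp_X)^Θ`, the image of `Δ^tp_X` ([EtTh] PRIMS p. 238).
[cite: MochizukiEtTh2009, §1 p.238] -/
def deltaTpTheta : Subgroup D.PiTheta := D.delta.map (QuotientGroup.mk' D.thetaKer)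

/-- `(Δ^tp_X)^ell ⊆ (Π^tp_X)^ell`, the image of `Δ^tp_X` ([EtTh] PRIMS p. 238).
[cite: MochizukiEtTh2009, §1 p.238] -/
def deltaTpEll : Subgroup D.PiEll := D.delta.map (QuotientGroup.mk' D.ellKer)

/-- `(Π^tp_Y)^Θ ⊆ (Π^tp_X)^Θ`, the image of `Π^tp_Y` ("the quotients of `Π^tp_Y, Δ^tp_Y` induced by
the quotients of `Π^tp_X, Δ^tp_X` with similar superscripts", [EtTh] PRIMS p. 238).
[cite: MochizukiEtTh2009, §1 p.238] -/
def piYTheta : Subgroup D.PiTheta := D.piY.map (QuotientGroup.mk' D.thetaKer)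

/-- `(Π^tp_Y)^ell ⊆ (Π^tp_X)^ell`, the image of `Π^tp_Y` ([EtTh] PRIMS p. 238).
[cite: MochizukiEtTh2009, §1 p.238] -/
def piYEll : Subgroup D.PiEll := D.piY.map (QuotientGroup.mk' D.ellKer)

/-- `(Δ^tp_Y)^Θ`, the image of `Δ^tp_Y` in `(Π^tp_X)^Θ` ([EtTh] PRIMS p. 238).
[cite: MochizukiEtTh2009, §1 p.238] -/
def deltaYTheta : Subgroup D.PiTheta := D.deltaY.map (QuotientGroup.mk' D.thetaKer)

/-- `(Δ^tp_Y)^ell`, the image of `Δ^tp_Y` in `(Π^tp_X)^ell` ([EtTh] PRIMS p. 238: "Thus,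
`(Δ^tp_Y)^ell ≅ Ẑ(1)`"). [cite: MochizukiEtTh2009, §1 p.238] -/
def deltaYEll : Subgroup D.PiEll := D.deltaY.map (QuotientGroup.mk' D.ellKer)

/-- `(Π^tp_X)^Θ ↠ (Π^tp_X)^ell` ([EtTh] PRIMS p. 238). [cite: MochizukiEtTh2009, §1 p.238] -/
def piThetaToEll : D.PiTheta →* D.PiEll :=
  QuotientGroup.map _ _ (MonoidHom.id _) (by rw [Subgroup.comap_id]; exact D.thetaKer_le_ellKer)

/-- The augmentation `(Π^tp_X)^ell ↠ G_K` (the kernels above lie in `Δ^tp_X = Ker(aug)`), whose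
restriction `(Π^tp_Y)^ell ↠ G_K` is "the natural surjection" of [EtTh] PRIMS p. 239.
[cite: MochizukiEtTh2009, §1 p.239] -/
def piEllAug : D.PiEll →* Field.absoluteGaloisGroup K :=
  QuotientGroup.lift D.ellKer D.aug.toMonoidHom fun x hx => (D.mem_delta_iff x).mp hx.1

end OncePuncturedTemperedGroup

end Literature.AnabelianGeometry.SemiGraphs

end
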